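import Mathlib.NumberTheory.Chebyshev
import Mathlib.NumberTheory.Primorial
import Mathlib.NumberTheory.PrimeCounting
import Mathlib.Analysis.Calculus.Deriv.MeanValue
import Mathlib.Analysis.Complex.ExponentialBounds
import Mathlib.NumberTheory.Harmonic.EulerMascheroni
import Literature.NumberTheory.LFunctions.LogIntegralProofs
import Literature.NumberTheory.LFunctions.LogIntegralTwoPosProofs
import Literature.NumberTheory.LFunctions.LogIntegralStrictMonoProofs
import Literature.NumberTheory.LFunctions.ChebyshevThetaSqrtBounds
import HarnessLib

/-!
# Nicolas's `A(x) = li(θ(x)) − π(x)`: monotonicity below the `θ`-crossover and the unconditional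
# positive range (Nicolas 2017, Prop. 3.5 and Prop. 3.6 (i))

Topic: `Literature/NumberTheory/LFunctions`. Robin (Ann. Fac. Sci. Toulouse 6 (1984) 257–268,
Thm. 1) proved that "`A(x) = Li(θ(x)) − π(x) > 0` pour `x` assez grand" is EQUIVALENT to the Riemann
Hypothesis, and Nicolas (*Estimates of `li(θ(x)) − π(x)` and the Riemann Hypothesis*, Springer PROMS
221 (2017) 587–610) made it effective: RH ⟺ `A(x) > 0` for every `x ≥ 11` (Thm. 1.1 (1.8) with
Cor. 1.1). This file vendors, as THEOREMS, the two unconditional structural statements of that paper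
that make the criterion's finite ranges cheap (survey row C18 of the rh-explicit slice (c) file
`run/shared/lean/pub/rh-explicit/survey/SLICE-arith.md` §7):

* `Nicolas2017_prop35_step` — the printed jump computation of **Prop. 3.5**: at a prime `p` with
  `θ(p) < p` one has `A(p) − A(p−) = −1 + ∫_{θ(p−)}^{θ(p)} dt/log t > log p / log θ(p) − 1 > 0`, so
  `A` does not decrease across `p`; between primes `A` is constant
  [cite: Nicolas2017, Prop. 3.5, proof (p. 14 of the HAL text hal-02078840)];
* `Nicolas2017_monotoneOn_of_theta_lt` — hence `A` is nondecreasing on `[3, X]` as soon as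
  `θ(p) < p` for every prime `p ≤ X` (Prop. 3.5 prints this with `X = 1.39·10¹⁷`, the Platt–Trudgian
  range of `θ(x) < x`);
* `Nicolas2017_liThetaSubPi_eleven_pos` — `A(11) > 0` (printed: `A(11) = 0.1301…`; here certified as
  `li(log 2310) > 5` from Ramanujan's series by which `logIntegral` is defined, with `γ > 1/2`,
  `log 2310 ≥ 7.74`, `log 7.74 ≥ 2.046`, `log 2.046 ≥ 0.7155`);
* `Nicolas2017_pos_of_theta_lt` — `θ(p) < p ∀ p ≤ X` ⇒ `A(x) > 0` for `11 ≤ x ≤ X` (the mechanism of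
  **Prop. 3.6 (i)**), and its two instances on printed `θ < x` ranges already in the tree:
  `Nicolas2017_prop36_i` — AS PRINTED, "(3.24) For `11 ≤ x ≤ 1.39·10¹⁷` we have `A(x) > 0`", from the
  named fact `PlattTrudgian2016_theta_lt` [cite: Nicolas2017, Prop. 3.6 (i)], and
  `Nicolas2017_pos_of_buthe2018` — the same for `11 ≤ x ≤ 10¹⁹` from `Buthe2018_thm2_theta` (Büthe,
  Math. Comp. 87 (2018) Thm. 2; NOT printed in [Nicolas2017], which predates it — a one-line
  consequence recorded for the survey's range cell).

NOT typed here (no new named facts, D-0026): the RH-conditional Thm. 1.1 ((1.6)–(1.10): the constants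
`2 ± λ`, `λ = Σ_ρ 1/|ρ|² = 0.04619…`, `M = 5.0643…`) and the `¬RH ⇒ A(x) = Ω±(x^b)` half (Robin 1984,
Lemma 2) — both need the explicit formula for `Π(x)` with effective constants (L-size).

Conventions: `θ = Chebyshev.theta` (Mathlib), `π = Nat.primeCounting` (Mathlib, evaluated at `⌊x⌋₊`),
`li = Literature.NumberTheory.LFunctions.logIntegral` (Ramanujan-series definition; all its analytic
API used here — derivative `1/log`, strict monotonicity, summability — is PROVED in the
`LogIntegral*Proofs` files). `A` is only meaningful for `x ≥ 3` (`θ(x) > 1`); Nicolas uses `x ≥ 2`.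

## References
* [Nicolas2017] J.-L. Nicolas, *Estimates of li(θ(x)) − π(x) and the Riemann Hypothesis*, in:
  Analytic Number Theory, Modular Forms and q-Hypergeometric Series, Springer PROMS 221 (2017)
  587–610, doi 10.1007/978-3-319-68376-8_32 (HAL hal-02078840). Prop. 3.5, Prop. 3.6 (i), Thm. 1.1.
* [Robin1984Toulouse] G. Robin, *Sur la différence Li(θ(x)) − π(x)*, Ann. Fac. Sci. Toulouse (5) 6
  (1984) 257–268, doi 10.5802/afst.611, Thm. 1.
* [PlattTrudgian2016Theta] D. J. Platt, T. S. Trudgian, Math. Comp. 85 (2016), Thm. 1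
  (`PlattTrudgian2016_theta_lt`).
* [Buthe2018] J. Büthe, Math. Comp. 87 (2018) 1991–2009, Thm. 2 (`Buthe2018_thm2_theta`).
-/

noncomputable section

open Real Set
open scoped Chebyshev Nat.Prime

namespace Literature.NumberTheory.LFunctions

/-- Nicolas's `A(x) := li(θ(x)) − π(x)` (Nicolas 2017, (1.1); Robin 1984 writes `Li(θ(x)) − π(x)`
with `Li` = the principal-value logarithmic integral `li`). `θ = Chebyshev.theta`,
`π(x) = Nat.primeCounting ⌊x⌋₊`, `li = logIntegral`. Meaningful for `x ≥ 3` (then `θ x > 1`).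
[cite: Nicolas2017, (1.1)] -/
def liThetaSubPi (x : ℝ) : ℝ :=
  logIntegral (θ x) - (Nat.primeCounting ⌊x⌋₊ : ℝ)

/-- Unfolding lemma for `liThetaSubPi` (Nicolas's (1.1)). [cite: Nicolas2017, (1.1)] -/
theorem liThetaSubPi_def (x : ℝ) :
    liThetaSubPi x = logIntegral (θ x) - (Nat.primeCounting ⌊x⌋₊ : ℝ) := rfl

/-- `A(x) = A(⌊x⌋)`: both `θ` and `π` only see the integer part (Nicolas 2017 uses it as "for
`p ≤ x < p⁺` one has `A(x) = A(p)`", proof of Prop. 3.6 (v)).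
[cite: Nicolas2017, proof of Prop. 3.6 (v)] -/
theorem liThetaSubPi_eq_floor (x : ℝ) : liThetaSubPi x = liThetaSubPi (⌊x⌋₊ : ℕ) := by
  rw [liThetaSubPi, liThetaSubPi, Chebyshev.theta_eq_theta_coe_floor x, Nat.floor_natCast]

/-! ### Elementary bookkeeping: `θ` and `π` across `n ↦ n + 1` -/

namespace Nicolas2017

/-- `θ(n+1) = θ(n) + [n+1 prime] log(n+1)`. [folklore] -/
private theorem theta_natCast_succ (n : ℕ) :
    θ ((n + 1 : ℕ) : ℝ) = θ (n : ℝ) + (if (n + 1).Prime then Real.log ((n : ℝ) + 1) else 0) := by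
  rw [Chebyshev.theta, Chebyshev.theta, Nat.floor_natCast, Nat.floor_natCast,
    Finset.sum_filter, Finset.sum_filter, Finset.sum_Ioc_succ_top (Nat.zero_le n)]
  push_cast
  rfl

/-- `π(n+1) = π(n) + [n+1 prime]`. [folklore] -/
private theorem primeCounting_succ (n : ℕ) :
    Nat.primeCounting (n + 1) = Nat.primeCounting n + (if (n + 1).Prime then 1 else 0) := by
  simp [Nat.primeCounting, Nat.primeCounting', Nat.count_succ]

end Nicolas2017

/-! ### The mean-value lower bound for `li` -/

/-- `li(b) − li(a) ≥ (b − a)/log b` for `1 < a ≤ b`: `li' = 1/log` is decreasing on `(1, ∞)`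
(Abramowitz–Stegun 5.1.3; the step "∫_{θ(p−)}^{θ(p)} dt/log t > (θ(p) − θ(p−))/log θ(p)" of
Nicolas 2017, proof of Prop. 3.5). [cite: Nicolas2017, proof of Prop. 3.5] -/
theorem sub_div_log_le_logIntegral_sub {a b : ℝ} (ha : 1 < a) (hab : a ≤ b) :
    (b - a) / Real.log b ≤ logIntegral b - logIntegral a := by
  have hb : 1 < b := lt_of_lt_of_le ha hab
  have hD : Convex ℝ (Icc a b) := convex_Icc a b
  have hderiv : ∀ x ∈ Icc a b, HasDerivAt logIntegral (Real.log x)⁻¹ x := fun x hx =>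
    hasDerivAt_logIntegral_holds (lt_of_lt_of_le ha hx.1)
  have hcont : ContinuousOn logIntegral (Icc a b) := fun x hx =>
    (hderiv x hx).continuousAt.continuousWithinAt
  have hdiff : DifferentiableOn ℝ logIntegral (interior (Icc a b)) := fun x hx =>
    (hderiv x (interior_subset hx)).differentiableAt.differentiableWithinAt
  have hge : ∀ x ∈ interior (Icc a b), (Real.log b)⁻¹ ≤ deriv logIntegral x := by
    intro x hx
    have hx' : x ∈ Icc a b := interior_subset hx
    rw [(hderiv x hx').deriv]
    have hx1 : 1 < x := lt_of_lt_of_le ha hx'.1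
    have hlogx : 0 < Real.log x := Real.log_pos hx1
    have hlogb : Real.log x ≤ Real.log b := Real.log_le_log (by linarith) hx'.2
    exact inv_anti₀ hlogx hlogb
  have h := hD.mul_sub_le_image_sub_of_le_deriv hcont hdiff hge a (left_mem_Icc.mpr hab) b
    (right_mem_Icc.mpr hab) hab
  rw [div_eq_inv_mul]
  exact h

/-! ### Prop. 3.5: the jump of `A` at an integer -/

/-- **Nicolas 2017, Prop. 3.5 (the step).** For a natural `n ≥ 3`: if `n + 1` is composite then
`A(n+1) = A(n)`; if `n + 1 = p` is prime and `θ(p) < p` then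
`A(p) − A(n) = li(θ(n) + log p) − li(θ(n)) − 1 ≥ log p / log θ(p) − 1 > 0`. In either case
`A(n) ≤ A(n+1)`. [cite: Nicolas2017, Prop. 3.5 (proof)] -/
theorem Nicolas2017_prop35_step {n : ℕ} (hn : 3 ≤ n)
    (hθ : (n + 1).Prime → θ ((n + 1 : ℕ) : ℝ) < (n + 1 : ℕ)) :
    liThetaSubPi (n : ℝ) ≤ liThetaSubPi ((n + 1 : ℕ) : ℝ) := by
  rw [liThetaSubPi, liThetaSubPi, Nat.floor_natCast, Nat.floor_natCast, Nicolas2017.theta_natCast_succ,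
    Nicolas2017.primeCounting_succ]
  by_cases hp : (n + 1).Prime
  · -- the prime case
    simp only [hp, if_true]
    push_cast
    have ha : 1 < θ (n : ℝ) := one_lt_theta (by exact_mod_cast hn)
    have hp2 : (2 : ℝ) ≤ (n : ℝ) + 1 := by
      have : (3 : ℝ) ≤ (n : ℝ) := by exact_mod_cast hn
      linarith
    have hlogp : 0 < Real.log ((n : ℝ) + 1) := Real.log_pos (by linarith)
    set a := θ (n : ℝ) with ha_def
    set b := θ (n : ℝ) + Real.log ((n : ℝ) + 1) with hb_def
    have hab : a ≤ b := by simp [hb_def, ha_def]; exact hlogp.le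
    have hb1 : 1 < b := lt_of_lt_of_le ha hab
    -- `θ(p) < p`, read on `b = θ(p)`
    have hbp : b < (n : ℝ) + 1 := by
      have h := hθ hp
      rw [Nicolas2017.theta_natCast_succ, if_pos hp] at h
      push_cast at h
      exact h
    have hlogb : 0 < Real.log b := Real.log_pos hb1
    have hlogbp : Real.log b < Real.log ((n : ℝ) + 1) := Real.log_lt_log (by linarith) hbp
    -- mean value: li b − li a ≥ (b − a)/log b = log p / log b > 1
    have hmv := sub_div_log_le_logIntegral_sub ha hab
    have hba : b - a = Real.log ((n : ℝ) + 1) := by simp [hb_def, ha_def]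
    rw [hba] at hmv
    have hgt : 1 < Real.log ((n : ℝ) + 1) / Real.log b := by
      rw [lt_div_iff₀ hlogb]; linarith
    linarith
  · simp [hp]

/-- **Nicolas 2017, Prop. 3.5 (integer form).** If `θ(p) < p` for every prime `p ≤ N`, then
`m ↦ A(m)` is nondecreasing on the naturals `3 ≤ m ≤ N`. [cite: Nicolas2017, Prop. 3.5] -/
theorem Nicolas2017_prop35_nat {N : ℕ} (hθ : ∀ p : ℕ, p.Prime → p ≤ N → θ (p : ℝ) < p)
    {m n : ℕ} (hm : 3 ≤ m) (hmn : m ≤ n) (hnN : n ≤ N) :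
    liThetaSubPi (m : ℝ) ≤ liThetaSubPi (n : ℝ) := by
  induction n, hmn using Nat.le_induction with
  | base => exact le_rfl
  | succ k hmk ih =>
    have hk : liThetaSubPi (m : ℝ) ≤ liThetaSubPi (k : ℝ) := ih (Nat.le_of_succ_le hnN)
    have hstep : liThetaSubPi (k : ℝ) ≤ liThetaSubPi ((k + 1 : ℕ) : ℝ) :=
      Nicolas2017_prop35_step (le_trans hm hmk) (fun hp => hθ (k + 1) hp hnN)
    exact le_trans hk hstep

/-- **Nicolas 2017, Prop. 3.5 (real form, as printed: "For `x < 1.39·10¹⁷`, `A(x)` is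
nondecreasing", with the Platt–Trudgian range replaced by the hypothesis it is used through).**
If `θ(p) < p` for every prime `p ≤ X`, then `A` is nondecreasing on `[3, X]`.
[cite: Nicolas2017, Prop. 3.5] -/
theorem Nicolas2017_monotoneOn_of_theta_lt {X : ℝ} (hθ : ∀ p : ℕ, p.Prime → (p : ℝ) ≤ X → θ (p : ℝ) < p) :
    MonotoneOn liThetaSubPi (Icc 3 X) := by
  intro x hx y hy hxy
  rw [liThetaSubPi_eq_floor x, liThetaSubPi_eq_floor y]
  have hx0 : 0 ≤ x := by linarith [hx.1]
  have hy0 : 0 ≤ y := by linarith [hy.1]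
  have h3x : 3 ≤ ⌊x⌋₊ := Nat.le_floor (by exact_mod_cast hx.1)
  have hfl : ⌊x⌋₊ ≤ ⌊y⌋₊ := Nat.floor_le_floor hxy
  refine Nicolas2017_prop35_nat (N := ⌊y⌋₊) (fun p hp hpN => hθ p hp ?_) h3x hfl le_rfl
  exact le_trans (by exact_mod_cast hpN) ((Nat.floor_le hy0).trans hy.2)

/-! ### `A(11) > 0`: the one numerical input -/

namespace Nicolas2017

/-- `exp(7.74) ≤ 2310`, i.e. `log 2310 ≥ 7.74` (`log 2310 = 7.7450…`). [folklore] -/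
private theorem exp_774_le : Real.exp (387 / 50) ≤ 2310 := by
  have h1 : Real.exp (387 / 50) = Real.exp 1 ^ 7 * Real.exp (37 / 50) := by
    rw [← Real.exp_nat_mul, ← Real.exp_add]; norm_num
  have h2 : Real.exp (37 / 50 : ℝ) ≤ _ :=
    Real.exp_bound' (by norm_num) (by norm_num) (n := 12) (by norm_num)
  norm_num [Finset.sum_range_succ, Nat.factorial] at h2
  have h3 : Real.exp 1 ^ 7 ≤ (2.7182818286 : ℝ) ^ 7 :=
    pow_le_pow_left₀ (Real.exp_pos 1).le Real.exp_one_lt_d9.le 7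
  rw [h1]
  calc Real.exp 1 ^ 7 * Real.exp (37 / 50) ≤ (2.7182818286 : ℝ) ^ 7 * Real.exp (37 / 50) := by
        gcongr
    _ ≤ 2310 := by nlinarith [h2, Real.exp_pos (37 / 50 : ℝ)]

/-- `exp(2.046) ≤ 7.74`, i.e. `log 7.74 ≥ 2.046` (`log 7.74 = 2.0464…`). [folklore] -/
private theorem exp_2046_le : Real.exp (1023 / 500) ≤ 387 / 50 := by
  have h1 : Real.exp (1023 / 500) = Real.exp 1 ^ 2 * Real.exp (23 / 500) := by
    rw [← Real.exp_nat_mul, ← Real.exp_add]; norm_num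
  have h2 : Real.exp (23 / 500 : ℝ) ≤ _ :=
    Real.exp_bound' (by norm_num) (by norm_num) (n := 8) (by norm_num)
  norm_num [Finset.sum_range_succ, Nat.factorial] at h2
  have h3 : Real.exp 1 ^ 2 ≤ (2.7182818286 : ℝ) ^ 2 :=
    pow_le_pow_left₀ (Real.exp_pos 1).le Real.exp_one_lt_d9.le 2
  rw [h1]
  calc Real.exp 1 ^ 2 * Real.exp (23 / 500) ≤ (2.7182818286 : ℝ) ^ 2 * Real.exp (23 / 500) := by
        gcongr
    _ ≤ 387 / 50 := by nlinarith [h2, Real.exp_pos (23 / 500 : ℝ)]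

/-- `exp(0.7155) ≤ 2.046`, i.e. `log 2.046 ≥ 0.7155` (`log 2.046 = 0.71589…`). [folklore] -/
private theorem exp_07155_le : Real.exp (1431 / 2000) ≤ 1023 / 500 := by
  have h2 : Real.exp (1431 / 2000 : ℝ) ≤ _ :=
    Real.exp_bound' (by norm_num) (by norm_num) (n := 14) (by norm_num)
  norm_num [Finset.sum_range_succ, Nat.factorial] at h2
  linarith

/-- `θ(11) = log 2310`. [folklore] -/
private theorem theta_eleven : θ (11 : ℝ) = Real.log 2310 := by
  have h : θ (11 : ℝ) = Real.log (primorial ⌊(11 : ℝ)⌋₊) := Chebyshev.theta_eq_log_primorial 11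
  have h11 : ⌊(11 : ℝ)⌋₊ = 11 := by
    have : ((11 : ℕ) : ℝ) = 11 := by norm_num
    rw [← this, Nat.floor_natCast]
  have hp : primorial 11 = 2310 := by decide
  rw [h, h11, hp]; push_cast; rfl

/-- `π(11) = 5`. [folklore] -/
private theorem primeCounting_eleven : Nat.primeCounting 11 = 5 := by decide

/-- `li(log 2310) > 5` (numerically `li(7.7450…) = 5.1301…`): from Ramanujan's series
`li y = γ + log log y + Σ_{n≥1} (log y)^n/(n·n!)` truncated at 14 terms, with `γ > 1/2`
(`Real.one_half_lt_eulerMascheroniConstant`), `log 2310 ≥ 7.74`, `log 7.74 ≥ 2.046`,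
`log 2.046 ≥ 0.7155`. [cite: Nicolas2017, Prop. 3.6 (i): "A(11) = 0.1301…"] -/
theorem five_lt_logIntegral_log_2310 : 5 < logIntegral (Real.log 2310) := by
  -- y = log 2310 ≥ 7.74
  have hy : (387 / 50 : ℝ) ≤ Real.log 2310 := by
    rw [Real.le_log_iff_exp_le (by norm_num)]; exact exp_774_le
  have hy1 : (1 : ℝ) ≤ Real.log 2310 := by linarith
  -- u = log y ≥ 2.046
  have hu : (1023 / 500 : ℝ) ≤ Real.log (Real.log 2310) := by
    have h1 : (1023 / 500 : ℝ) ≤ Real.log (387 / 50) := by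
      rw [Real.le_log_iff_exp_le (by norm_num)]; exact exp_2046_le
    exact h1.trans (Real.log_le_log (by norm_num) hy)
  have hu0 : (0 : ℝ) ≤ Real.log (Real.log 2310) := by linarith
  -- log u ≥ 0.7155
  have hlu : (1431 / 2000 : ℝ) ≤ Real.log (Real.log (Real.log 2310)) := by
    have h1 : (1431 / 2000 : ℝ) ≤ Real.log (1023 / 500) := by
      rw [Real.le_log_iff_exp_le (by norm_num)]; exact exp_07155_le
    exact h1.trans (Real.log_le_log (by norm_num) hu)
  -- the series: tsum ≥ partial sum over 14 terms ≥ the same partial sum at u₀ = 2.046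
  have hsum : Summable (logIntegralSeriesTerm (Real.log 2310)) := summable_logIntegralSeriesTerm _
  have hpart : ∑ n ∈ Finset.range 14, logIntegralSeriesTerm (Real.log 2310) n ≤
      ∑' n, logIntegralSeriesTerm (Real.log 2310) n :=
    hsum.sum_le_tsum (Finset.range 14) (fun n _ => logIntegralSeriesTerm_nonneg hy1 n)
  have hterm : ∀ n : ℕ, (1023 / 500 : ℝ) ^ (n + 1) / ((n + 1 : ℝ) * ((n + 1).factorial : ℝ)) ≤
      logIntegralSeriesTerm (Real.log 2310) n := by
    intro n
    unfold logIntegralSeriesTerm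
    exact div_le_div_of_nonneg_right (pow_le_pow_left₀ (by norm_num) hu (n + 1)) (by positivity)
  have hpart0 : ∑ n ∈ Finset.range 14, (1023 / 500 : ℝ) ^ (n + 1) / ((n + 1 : ℝ) * ((n + 1).factorial : ℝ))
      ≤ ∑ n ∈ Finset.range 14, logIntegralSeriesTerm (Real.log 2310) n :=
    Finset.sum_le_sum fun n _ => hterm n
  have hval : (37845 / 10000 : ℝ) <
      ∑ n ∈ Finset.range 14, (1023 / 500 : ℝ) ^ (n + 1) / ((n + 1 : ℝ) * ((n + 1).factorial : ℝ)) := by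
    norm_num [Finset.sum_range_succ, Nat.factorial]
  have hγ := Real.one_half_lt_eulerMascheroniConstant
  unfold logIntegral
  linarith

end Nicolas2017

/-- **`A(11) > 0`** (Nicolas 2017: `A(11) = 0.1301…`; `A(7) = −0.1541 < 0`, so `11` is sharp among
the primes). [cite: Nicolas2017, Prop. 3.6 (i) (proof)] -/
theorem Nicolas2017_liThetaSubPi_eleven_pos : 0 < liThetaSubPi 11 := by
  rw [liThetaSubPi, Nicolas2017.theta_eleven]
  have h11 : ⌊(11 : ℝ)⌋₊ = 11 := by
    have : ((11 : ℕ) : ℝ) = 11 := by norm_num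
    rw [← this, Nat.floor_natCast]
  rw [h11, Nicolas2017.primeCounting_eleven]
  push_cast
  linarith [Nicolas2017.five_lt_logIntegral_log_2310]

/-! ### Prop. 3.6 (i): the unconditional positive range -/

/-- **The mechanism of Nicolas 2017, Prop. 3.6 (i).** If `θ(p) < p` for every prime `p ≤ X`, then
`A(x) = li(θ(x)) − π(x) > 0` for every real `11 ≤ x ≤ X` (`A` is nondecreasing on `[3, X]` by
Prop. 3.5 and `A(11) > 0`). A finite `θ`-check, or any theorem giving `θ(x) < x` on `[11, X]`, is
thereby a certificate for the named range `[11, X]` of the Robin–Nicolas criterion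
"RH ⟺ `A(x) > 0` for all `x ≥ 11`". [cite: Nicolas2017, Prop. 3.6 (i) with Prop. 3.5] -/
theorem Nicolas2017_pos_of_theta_lt {X : ℝ} (hθ : ∀ p : ℕ, p.Prime → (p : ℝ) ≤ X → θ (p : ℝ) < p)
    {x : ℝ} (h11 : 11 ≤ x) (hxX : x ≤ X) : 0 < liThetaSubPi x := by
  have hmono := Nicolas2017_monotoneOn_of_theta_lt hθ
  have h11mem : (11 : ℝ) ∈ Icc 3 X := ⟨by norm_num, le_trans h11 hxX⟩
  have hxmem : x ∈ Icc 3 X := ⟨by linarith, hxX⟩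
  exact lt_of_lt_of_le Nicolas2017_liThetaSubPi_eleven_pos (hmono h11mem hxmem h11)

/-- **Nicolas 2017, Prop. 3.6 (i), AS PRINTED: "(3.24) For `11 ≤ x ≤ 1.39·10¹⁷` we have
`A(x) > 0`"** — from the Platt–Trudgian 2016 range of `θ(x) < x` (the tree's named fact
`PlattTrudgian2016_theta_lt`, exactly the input (2.1) of the paper). [cite: Nicolas2017, Prop. 3.6 (i)] -/
theorem Nicolas2017_prop36_i (hPT : PlattTrudgian2016_theta_lt) {x : ℝ} (h11 : 11 ≤ x)
    (hx : x ≤ 139 * 10 ^ 15) : 0 < liThetaSubPi x :=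
  Nicolas2017_pos_of_theta_lt (X := 139 * 10 ^ 15)
    (fun p hp hpX => hPT p (by exact_mod_cast hp.pos) hpX) h11 hx

/-- The same range pushed to `10¹⁹` by Büthe 2018, Thm. 2 (`θ(x) < x` for `1 ≤ x ≤ 10¹⁹`, the tree's
named fact `Buthe2018_thm2_theta` through its proved corollary `.theta_lt`): `A(x) > 0` for
`11 ≤ x ≤ 10¹⁹`. NOT printed in [Nicolas2017] (which predates Büthe's theorem); a one-line
consequence of Prop. 3.5/3.6 recorded for the survey's range cell.
[cite: Nicolas2017, Prop. 3.6 (i) (mechanism)] [cite: Buthe2018, Thm. 2] -/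
theorem Nicolas2017_pos_of_buthe2018 (hB : Buthe2018_thm2_theta) {x : ℝ} (h11 : 11 ≤ x)
    (hx : x ≤ (10 : ℝ) ^ 19) : 0 < liThetaSubPi x :=
  Nicolas2017_pos_of_theta_lt (X := (10 : ℝ) ^ 19)
    (fun p hp hpX => hB.theta_lt (by exact_mod_cast hp.one_lt.le) hpX) h11 hx

end Literature.NumberTheory.LFunctions

end
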